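import Literature.Geometry.Riemannian.GurskyViaclovskyBackgroundNaturalityC2
import Literature.Geometry.Riemannian.GurskyViaclovskyClosednessChartEquation
import HarnessLib

/-!
# Gursky–Viaclovsky: the background equation in a chart for `C²` functions

Support file (everything PROVED; no definition, no named fact) for the Gursky–Viaclovsky
continuity method behind `Literature.Geometry.Riemannian.gurskyViaclovsky_pathClosed_weighted_four`
and its openness companion. The chart form of the background equation,
`backgroundPathOperator g t (−u) (Φ y) = chartOperator G_c t (|W_g|²(Φ y)) y (DU(y)) (D²U(y))`
(`backgroundPathOperator_chart_eq_chartOperator` of the ChartEquation file, `Φ = (chartAt c)⁻¹`,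
`U = u ∘ Φ`), is stated there for SMOOTH `u`. The identity is pointwise and of second order —
both sides are polynomials in the `2`-jet of `u` at the point, with the curvature data of `g` as
coefficients — and the openness half of the continuity method (the implicit function theorem in
`C^{2,α}`) as well as the regularity bootstrap handle `C^{2,α}` functions, which are `C²` but not
`C^∞`. This file re-proves the chain under the hypothesis "`C²` at the point" (the frame
expansion and the naturality for `C²` functions are in `GurskyViaclovskyBackgroundNaturalityC2.lean`):

* `backgroundPathOperator_eq_chartOperator_of_contDiffAt_two` — on an open `U ⊆ ℝ⁴` with metric
  components `G`: `backgroundPathOperator g t (−f) y = chartOperator G t (|W_g|²(y)) y (DF(y)) (D²F(y))`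
  for `f` with a representative `F` of class `C²` at `y` (the chart dictionary
  `hessian_eq_hessAt`, `dalembertian_eq_lapAt`, `mvfderiv_eq` needs `C²` at the point only);
* `contDiffAt_comp_chart_symm_of_contMDiffAt` — `u ∘ (chartAt c)⁻¹` is `Cⁿ` at `y` when `u` is
  `Cⁿ` at `(chartAt c)⁻¹ y` (the `Cⁿ` version of `ChartInverseSelf.contDiffAt_comp_symm`);
* `backgroundPathOperator_chart_eq_chartOperator_of_contMDiffAt_two`,
  `backgroundPathOperator_chart_eq_chartOperator_of_contMDiff_two` — the background equation in
  the preferred chart at `c` for `u : M → ℝ` of class `C²` (at the point, resp. everywhere), with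
  the same right-hand side as the smooth statement, symbol for symbol.

Nothing here is new mathematics: the statements are those of the ChartEquation file with
`ContMDiff … ∞` weakened to `ContMDiffAt … 2` at the point, and the proofs are the landed proofs
with that substitution.

## References

* M. J. Gursky, J. A. Viaclovsky, J. Differential Geom. 63 (2003) 131–154, §1 (change1)–(PDE),
  Prop. 6. [GurskyViaclovsky2003]
* B. O'Neill, *Semi-Riemannian Geometry* (1983), Ch. 3, Lemma 3.49. [ONeill1983]
-/

noncomputable section

open scoped Manifold ContDiff Topology
open Set Function Module Finset

namespace Literature.Geometry.Riemannian.GurskyViaclovskyPath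

open Literature.Geometry.Lorentzian (PseudoRiemannianMetric)
open Literature.Geometry.Lorentzian.PseudoRiemannianMetric
open Literature.Geometry.Lorentzian
open Literature.Geometry.Riemannian.GurskyViaclovsky

/-! ### The background operator on an open subset of `ℝ⁴` is the chart operator (`C²` version) -/

section OpensChart

variable {U : TopologicalSpace.Opens (EuclideanSpace ℝ (Fin 4))}
  (g : PseudoRiemannianMetric 𝓘(ℝ, EuclideanSpace ℝ (Fin 4)) ∞ (EuclideanSpace ℝ (Fin 4))
    (TangentSpace 𝓘(ℝ, EuclideanSpace ℝ (Fin 4)) : U → Type _))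
  [g.HasLeviCivita]
  {G : EuclideanSpace ℝ (Fin 4) →
    EuclideanSpace ℝ (Fin 4) →L[ℝ] EuclideanSpace ℝ (Fin 4) →L[ℝ] ℝ}
  (hG : ∀ y : U, g.val y = G y)

include hG in
/-- **The background operator is the chart operator of the `2`-jet of a `C²` representative.**
On an open set `U ⊆ ℝ⁴` carrying a Riemannian metric `g` with components `G`, for `f : U → ℝ`
with a representative `F` (`f = F` on `U`) of class `C²` at `y`:
`backgroundPathOperator g t (−f) y = chartOperator G t (|W_g|²(y)) y (DF(y)) (D²F(y))`
(the statement of `backgroundPathOperator_eq_chartOperator` without the global smoothness of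
`f`, which its proof used at order `2` at `y` only). [cite: GurskyViaclovsky2003, §1 (change1)–(PDE)] -/
theorem backgroundPathOperator_eq_chartOperator_of_contDiffAt_two (hg : g.IsRiemannian) (t : ℝ)
    {f : U → ℝ} {F : EuclideanSpace ℝ (Fin 4) → ℝ} (hfF : ∀ y : U, f y = F y) (y : U)
    (hF : ContDiffAt ℝ 2 F y) :
    backgroundPathOperator g t (fun z ↦ -f z) y =
      chartOperator G t (g.weylNormSq y) y (fderiv ℝ F y) (fderiv ℝ (fderiv ℝ F) y) := by
  -- adapted from `backgroundPathOperator_eq_chartOperator` (GurskyViaclovskyClosednessChartEquation.lean)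
  classical
  have hE : finrank ℝ (EuclideanSpace ℝ (Fin 4)) = 4 := finrank_euclideanSpace_fin
  have hn : (2 : ℕ∞ω) ≤ ((⊤ : ℕ∞) : ℕ∞ω) := WithTop.coe_le_coe.mpr le_top
  obtain ⟨b, hb⟩ := g.exists_basis_isOrthonormalFrame (x := y) (fun v hv ↦ hg y v hv) hE
  -- `f` is `C²` at `y` (as a map of the manifold `U`), since its representative is
  have hf2 : ContMDiffAt 𝓘(ℝ, EuclideanSpace ℝ (Fin 4)) 𝓘(ℝ) 2 f y := by
    rw [show f = fun z : U ↦ F z from funext hfF]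
    exact contMDiffAt_subtype_iff.mpr hF.contMDiffAt
  -- the `w = -f` jet in the frame
  set w : U → ℝ := fun z ↦ -f z with hw_def
  have hw2 : ContMDiffAt 𝓘(ℝ, EuclideanSpace ℝ (Fin 4)) 𝓘(ℝ) 2 w y := hf2.neg
  set R := g.scalarCurvature y with hR_def
  set Rc : Fin 4 → Fin 4 → ℝ := fun a c ↦ g.ricci y (b a) (b c) with hRc_def
  set Hw : Fin 4 → Fin 4 → ℝ := fun a c ↦ g.hessian w y (b a) (b c) with hHw_def
  set bw : Fin 4 → ℝ := fun a ↦ mvfderiv 𝓘(ℝ, EuclideanSpace ℝ (Fin 4)) w y (b a) with hbw_def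
  have hRc : ∀ a c, Rc a c = Rc c a := fun a c ↦ (g.ricci_symm_holds hn y).eq (b a) (b c)
  have hH : ∀ a c, Hw a c = Hw c a := fun a c ↦ (g.hessian_symm_holds hw2).eq (b a) (b c)
  have hRsum : ∑ a, Rc a a = R := hb.sum_ricci_eq_scalarCurvature g hE
  -- left-hand side: `4σ₂(B) − ¼|W|²` for the frame array `B = gvMatrix`
  have hL : backgroundPathOperator g t w y =
      4 * sigma2 (gvMatrix t R Rc Hw bw) - g.weylNormSq y / 4 := by
    rw [backgroundPathOperator_eq_framePoly_of_contMDiffAt_two g hw2 t hb,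
      sigma2WeylSchouten_eq_sigma2_frame g hg hb,
      framePoly_eq_sigma2_gvMatrix t (g.weylNormSq y) hRc hH hRsum bw]
  -- the dictionary at `y`
  have hGy : ∀ v w', G y v w' = g.val y v w' := fun v w' ↦
    (congrArg (fun B : EuclideanSpace ℝ (Fin 4) →L[ℝ] EuclideanSpace ℝ (Fin 4) →L[ℝ] ℝ ↦ B v w')
      (hG y)).symm
  have hδ : ∀ a c, G y (b a) (b c) = frameDelta a c := fun a c ↦ by
    rw [hGy]
    unfold frameDelta
    split_ifs with hac
    · subst hac; exact hb.1 a
    · exact hb.2 a c hac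
  have hric : ∀ a c, MetricCoord.ricAt G y (b a) (b c) = Rc a c := fun a c ↦
    (OpensChart.ricci_eq_ricAt hG y (b a) (b c)).symm
  have hscal : MetricCoord.scalAt G y = R := (OpensChart.scalarCurvature_eq_scalAt hG y).symm
  have hHess : ∀ a c, coordHess G y (fderiv ℝ F y) (fderiv ℝ (fderiv ℝ F) y) (b a) (b c) =
      -Hw a c := fun a c ↦ by
    rw [coordHess_jet, ← OpensChart.hessian_eq_hessAt hG y hfF hF (b a) (b c), hHw_def]
    change _ = -(g.hessian (-f) y (b a) (b c))
    rw [g.hessian_neg f y]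
    simp
  have hmtr : MetricCoord.mtrAt G y (coordHess G y (fderiv ℝ F y) (fderiv ℝ (fderiv ℝ F) y)) =
      -∑ a, Hw a a := by
    rw [coordHess_jet]
    change MetricCoord.lapAt G F y = _
    rw [← OpensChart.dalembertian_eq_lapAt hG y hfF hF, dalembertian_eq_sum_orthonormalFrame g f hb]
    have h : ∀ a, g.hessian f y (b a) (b a) = -Hw a a := fun a ↦ by
      rw [hHw_def]
      change _ = -(g.hessian (-f) y (b a) (b a))
      rw [g.hessian_neg f y]
      simp
    simp only [h, Finset.sum_neg_distrib]
  have hp : ∀ a, fderiv ℝ F y (b a) = -bw a := fun a ↦ by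
    rw [hbw_def]
    change _ = -(mvfderiv 𝓘(ℝ, EuclideanSpace ℝ (Fin 4)) (-f) y (b a))
    rw [mvfderiv_neg, ← OpensChart.mvfderiv_eq y f F hfF (hF.differentiableAt (by norm_num))]
    simp
  have hmv : mvfderiv 𝓘(ℝ, EuclideanSpace ℝ (Fin 4)) f y = fderiv ℝ F y :=
    ContinuousLinearMap.ext (OpensChart.mvfderiv_eq y f F hfF (hF.differentiableAt (by norm_num)))
  have hgrad : fderiv ℝ F y (MetricCoord.sharpAt G y (fderiv ℝ F y)) = ∑ a, bw a ^ 2 := by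
    have h1 : g.gradSq f y = ∑ a, bw a ^ 2 := by
      rw [gradSq_eq_sum_orthonormalFrame g f hb]
      refine Finset.sum_congr rfl fun a _ ↦ ?_
      rw [hbw_def]
      change _ = (mvfderiv 𝓘(ℝ, EuclideanSpace ℝ (Fin 4)) (-f) y (b a)) ^ 2
      rw [mvfderiv_neg]
      simp
    rw [← h1, PseudoRiemannianMetric.gradSq_eq, ← OpensChart.sharp_eq_sharpAt hG y, ← hmv]
    rfl
  -- the frame array of `gvForm` is `gvMatrix`
  set 𝒜 := gvForm G t y (fderiv ℝ F y) (fderiv ℝ (fderiv ℝ F) y) with h𝒜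
  have hM : ∀ a c, 𝒜 (b a) (b c) = gvMatrix t R Rc Hw bw a c := by
    intro a c
    rw [h𝒜, gvForm_apply, hric, hscal, hδ, hHess, hmtr, hp, hp, hgrad, gvMatrix]
    ring
  -- metric trace and square norm of `𝒜` in the frame
  have hO : (g.toBilinForm y).IsOrthoᵢ b := fun i j hij ↦ hb.2 i j hij
  have hcne : ∀ i, g.val y (b i) (b i) ≠ 0 := fun i ↦ by rw [hb.1 i]; exact one_ne_zero
  have htr : MetricCoord.mtrAt G y 𝒜 = ∑ a, gvMatrix t R Rc Hw bw a a := by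
    rw [← OpensChart.trace_eq_mtrAt hG y (toBilin 𝒜) 𝒜 (fun v w' ↦ rfl),
      g.trace_eq_sum_of_isOrthonormalFrame b hb]
    exact Finset.sum_congr rfl fun a _ ↦ hM a a
  have hns : MetricCoord.normSqAt G y 𝒜 = frameNormSq (gvMatrix t R Rc Hw bw) := by
    rw [← OpensChart.normSq_eq_normSqAt hG y (toBilin 𝒜) 𝒜 (fun v w' ↦ rfl),
      g.normSq_eq_sum_sq y b hO hcne, frameNormSq, Finset.sum_comm]
    refine Finset.sum_congr rfl fun a _ ↦ Finset.sum_congr rfl fun c _ ↦ ?_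
    rw [hb.1 a, hb.1 c, mul_one, div_one]
    show 𝒜 (b a) (b c) ^ 2 = _
    rw [hM a c]
  -- assemble
  rw [hL, chartOperator, ← h𝒜, htr, hns,
    sigma2_eq (gvMatrix_symm hRc hH bw), sigma1]
  ring

end OpensChart

/-! ### A `Cⁿ` function read through the inverse chart -/

section ChartInverse

variable {E : Type*} [NormedAddCommGroup E] [NormedSpace ℝ E]
  {X : Type*} [TopologicalSpace X] [ChartedSpace E X] {n : ℕ∞ω} [IsManifold 𝓘(ℝ, E) n X]

/-- A function on a `Cⁿ` manifold `X` modelled on `E` which is `Cⁿ` at `(chartAt x)⁻¹ u`, read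
through the inverse chart at `x`, is `Cⁿ` at the point `u` of the chart target (the pointwise,
finite-order version of `ChartInverseSelf.contDiffAt_comp_symm`). [folklore] -/
theorem contDiffAt_comp_chart_symm_of_contMDiffAt (x : X) {φ : X → ℝ} {u : E}
    (hu : u ∈ (chartAt E x).target) (hφ : ContMDiffAt 𝓘(ℝ, E) 𝓘(ℝ) n φ ((chartAt E x).symm u)) :
    ContDiffAt ℝ n (fun y : E ↦ φ ((chartAt E x).symm y)) u := by
  have hsymm : ContMDiffAt 𝓘(ℝ, E) 𝓘(ℝ, E) n (chartAt E x).symm u :=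
    (contMDiffOn_chart_symm (I := 𝓘(ℝ, E)) (x := x) (n := n)).contMDiffAt
      ((chartAt E x).open_target.mem_nhds hu)
  exact contMDiffAt_iff_contDiffAt.1 (hφ.comp u hsymm)

end ChartInverse

/-! ### Through the preferred chart of a `4`-manifold, for `C²` functions -/

section ManifoldChart

variable {M : Type*} [TopologicalSpace M] [ChartedSpace (EuclideanSpace ℝ (Fin 4)) M]
  [IsManifold (𝓡 4) ∞ M]
  (g : PseudoRiemannianMetric (𝓡 4) ∞ (EuclideanSpace ℝ (Fin 4)) (TangentSpace (𝓡 4) : M → Type _))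
  [g.HasLeviCivita]

/-- **The background equation in the preferred chart at `c`, for `u` of class `C²` at the point.**
Let `Φ = (chartAt c)⁻¹` on `U = (chartAt c).target`, `G_c` the components of `Φ^*g` (the
representative of its value, extended by `0` off `U`), `u : M → ℝ` of class `C²` at `Φ y` and
`U = u ∘ Φ`. Then
`backgroundPathOperator g t (−u) (Φ y) = chartOperator G_c t (|W_g|²(Φ y)) y (DU(y)) (D²U(y))`
(`backgroundPathOperator_comap_of_contMDiffAt_two` +
`backgroundPathOperator_eq_chartOperator_of_contDiffAt_two` + `weylNormSq_comap`) — the statement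
of `backgroundPathOperator_chart_eq_chartOperator` for `C²` instead of `C^∞` functions.
[cite: GurskyViaclovsky2003, §1 (change1)–(PDE) and Prop. 6] -/
theorem backgroundPathOperator_chart_eq_chartOperator_of_contMDiffAt_two (hg : g.IsRiemannian)
    (t : ℝ) {u : M → ℝ} (c : M) {y : EuclideanSpace ℝ (Fin 4)}
    (hy : y ∈ (chartAt (EuclideanSpace ℝ (Fin 4)) c).target)
    (hu : ContMDiffAt (𝓡 4) 𝓘(ℝ) 2 u ((chartAt (EuclideanSpace ℝ (Fin 4)) c).symm y)) :
    let U : TopologicalSpace.Opens (EuclideanSpace ℝ (Fin 4)) :=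
      ⟨(chartAt (EuclideanSpace ℝ (Fin 4)) c).target,
        (chartAt (EuclideanSpace ℝ (Fin 4)) c).open_target⟩
    let Φ : U → M := fun z ↦ (chartAt (EuclideanSpace ℝ (Fin 4)) c).symm z
    let gU := g.comap (contMDiff_pullbackBilin_holds) Φ (ChartInverseSelf.contMDiff_symm c)
      (ChartInverseSelf.injective_mfderiv_symm c) rfl
    backgroundPathOperator g t (fun m ↦ -u m) ((chartAt (EuclideanSpace ℝ (Fin 4)) c).symm y) =
      chartOperator
        (Function.extend (Subtype.val : U → EuclideanSpace ℝ (Fin 4))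
          (fun z : U ↦ (gU.val z :
            EuclideanSpace ℝ (Fin 4) →L[ℝ] EuclideanSpace ℝ (Fin 4) →L[ℝ] ℝ)) (fun _ ↦ 0))
        t (g.weylNormSq ((chartAt (EuclideanSpace ℝ (Fin 4)) c).symm y)) y
        (fderiv ℝ (fun z ↦ u ((chartAt (EuclideanSpace ℝ (Fin 4)) c).symm z)) y)
        (fderiv ℝ (fderiv ℝ (fun z ↦ u ((chartAt (EuclideanSpace ℝ (Fin 4)) c).symm z))) y) := by
  -- adapted from `backgroundPathOperator_chart_eq_chartOperator` (GurskyViaclovskyClosednessChartEquation.lean)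
  intro U Φ gU
  haveI : gU.HasLeviCivita := gU.hasLeviCivita
  set G : EuclideanSpace ℝ (Fin 4) →
      EuclideanSpace ℝ (Fin 4) →L[ℝ] EuclideanSpace ℝ (Fin 4) →L[ℝ] ℝ :=
    Function.extend (Subtype.val : U → EuclideanSpace ℝ (Fin 4))
      (fun z : U ↦ (gU.val z :
        EuclideanSpace ℝ (Fin 4) →L[ℝ] EuclideanSpace ℝ (Fin 4) →L[ℝ] ℝ)) (fun _ ↦ 0) with hGdef
  have hG : ∀ z : U, gU.val z = G z := fun z ↦ by
    rw [hGdef, Subtype.val_injective.extend_apply]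
  have hgU : gU.IsRiemannian := fun z v hv ↦ by
    have h1 : gU.val z v v = g.val (Φ z)
        (mfderiv 𝓘(ℝ, EuclideanSpace ℝ (Fin 4)) 𝓘(ℝ, EuclideanSpace ℝ (Fin 4)) Φ z v)
        (mfderiv 𝓘(ℝ, EuclideanSpace ℝ (Fin 4)) 𝓘(ℝ, EuclideanSpace ℝ (Fin 4)) Φ z v) := rfl
    rw [h1]
    exact hg _ _ fun h0 ↦ hv ((ChartInverseSelf.injective_mfderiv_symm c z) (by
      rw [h0]
      exact ((mfderiv 𝓘(ℝ, EuclideanSpace ℝ (Fin 4)) 𝓘(ℝ, EuclideanSpace ℝ (Fin 4)) Φ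
        z).map_zero).symm))
  set y' : U := ⟨y, hy⟩ with hy'
  -- naturality: the background operator of `Φ^*g` and `(-u) ∘ Φ` at `y'`
  have hnat := backgroundPathOperator_comap_of_contMDiffAt_two g (contMDiff_pullbackBilin_holds)
    (ChartInverseSelf.contMDiff_symm c) (ChartInverseSelf.injective_mfderiv_symm c) rfl hg
    (w := fun m ↦ -u m) t y' hu.neg
  have hW := g.weylNormSq_comap (contMDiff_pullbackBilin_holds) (ChartInverseSelf.contMDiff_symm c)
    (ChartInverseSelf.injective_mfderiv_symm c) rfl hg y'
  -- the chart operator for `f = u ∘ Φ` on `U`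
  have hF : ContDiffAt ℝ 2 (fun z ↦ u ((chartAt (EuclideanSpace ℝ (Fin 4)) c).symm z)) y :=
    contDiffAt_comp_chart_symm_of_contMDiffAt c hy hu
  have hchart := backgroundPathOperator_eq_chartOperator_of_contDiffAt_two gU hG hgU t
    (f := u ∘ Φ) (F := fun z ↦ u ((chartAt (EuclideanSpace ℝ (Fin 4)) c).symm z))
    (fun z ↦ rfl) y' hF
  have hcomp : (fun z : U ↦ -(u ∘ Φ) z) = (fun m ↦ -u m) ∘ Φ := rfl
  rw [hcomp, hnat, hW] at hchart
  exact hchart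

/-- **The background equation in the preferred chart at `c`, for `u ∈ C²(M)`**: the statement of
`backgroundPathOperator_chart_eq_chartOperator` with `ContMDiff … ∞ u` weakened to
`ContMDiff … 2 u` (from the pointwise version). This is the form in which the openness half of
the continuity method and the regularity bootstrap, which work with `C^{2,α}` functions, read
the weighted `σ₂` path equation in charts. [cite: GurskyViaclovsky2003, §1 (change1)–(PDE) and Prop. 6] -/
theorem backgroundPathOperator_chart_eq_chartOperator_of_contMDiff_two (hg : g.IsRiemannian)
    (t : ℝ) {u : M → ℝ} (hu : ContMDiff (𝓡 4) 𝓘(ℝ) 2 u) (c : M) {y : EuclideanSpace ℝ (Fin 4)}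
    (hy : y ∈ (chartAt (EuclideanSpace ℝ (Fin 4)) c).target) :
    let U : TopologicalSpace.Opens (EuclideanSpace ℝ (Fin 4)) :=
      ⟨(chartAt (EuclideanSpace ℝ (Fin 4)) c).target,
        (chartAt (EuclideanSpace ℝ (Fin 4)) c).open_target⟩
    let Φ : U → M := fun z ↦ (chartAt (EuclideanSpace ℝ (Fin 4)) c).symm z
    let gU := g.comap (contMDiff_pullbackBilin_holds) Φ (ChartInverseSelf.contMDiff_symm c)
      (ChartInverseSelf.injective_mfderiv_symm c) rfl
    backgroundPathOperator g t (fun m ↦ -u m) ((chartAt (EuclideanSpace ℝ (Fin 4)) c).symm y) =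
      chartOperator
        (Function.extend (Subtype.val : U → EuclideanSpace ℝ (Fin 4))
          (fun z : U ↦ (gU.val z :
            EuclideanSpace ℝ (Fin 4) →L[ℝ] EuclideanSpace ℝ (Fin 4) →L[ℝ] ℝ)) (fun _ ↦ 0))
        t (g.weylNormSq ((chartAt (EuclideanSpace ℝ (Fin 4)) c).symm y)) y
        (fderiv ℝ (fun z ↦ u ((chartAt (EuclideanSpace ℝ (Fin 4)) c).symm z)) y)
        (fderiv ℝ (fderiv ℝ (fun z ↦ u ((chartAt (EuclideanSpace ℝ (Fin 4)) c).symm z))) y) :=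
  backgroundPathOperator_chart_eq_chartOperator_of_contMDiffAt_two g hg t c hy (hu _)

end ManifoldChart

end Literature.Geometry.Riemannian.GurskyViaclovskyPath

end
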